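import Literature.NumberTheory.LFunctions.FordProgram1Run36A
import Literature.NumberTheory.LFunctions.FordProgram1Run36B
import Literature.NumberTheory.LFunctions.FordProgram1Run36C
import HarnessLib

/-!
# Ford's "Program 1": kernel run 36 (`1086 ≤ k ≤ 1100`)

Topic `Literature/NumberTheory/LFunctions`. Everything here is PROVED (standard axioms):
`FordP1.checkT k = true` for `1086 ≤ k ≤ 1100`, i.e. the certified re-run of PROGRAM 1 of
K. Ford, Proc. LMS 85 (2002) (the second part of Theorem 3) for these `k` — see `FordProgram1.lean`
for the checker, its soundness `FordP1.row_of_checkK`, and the meaning of the constants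
(`ρ = FordP1.rhoOf k / 10⁵`, `θ = FordP1.thetaOf k / 10⁴`, `ω = FordP1.omOf k / 10⁴`).

This file no longer performs a kernel evaluation of its own: the single 15-value `decide +kernel`
run that used to live here exceeded the full-build limits and was split into the three files
`FordProgram1Run36A.lean` (`1086 ≤ k ≤ 1091`), `FordProgram1Run36B.lean` (`1092 ≤ k ≤ 1096`) and
`FordProgram1Run36C.lean` (`1097 ≤ k ≤ 1100`), one `decide +kernel` per `k`. The range statement
`FordP1.run36` below (same statement as before) is assembled from `FordP1.run36A/B/C`; the
assembly of all runs is `FordTheorem3SmallK.lean` (which imports the split files directly).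

## References

* K. Ford, Proc. London Math. Soc. (3) 85 (2002), 565–633; arXiv:1910.08209: Theorem 3, (1.7),
  Lemmas 3.4–3.5, Appendix "PROGRAM 1". [Ford2002]
-/

namespace Literature.NumberTheory.LFunctions
namespace FordP1

/-- **Kernel run 36**: `checkT k` for `1086 ≤ k ≤ 1100` (assembled from the split kernel runs
`run36A`, `run36B`, `run36C`). [cite: Ford2002, Theorem 3 (second part) and PROGRAM 1] -/
theorem run36 : ((List.range' 1086 15).all checkT) = true := by
  rw [List.all_eq_true]
  intro k hk
  rw [List.mem_range'_1] at hk
  rcases Nat.lt_or_ge k 1092 with h | h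
  · exact run36A k hk.1 (by omega)
  rcases Nat.lt_or_ge k 1097 with h' | h'
  · exact run36B k h (by omega)
  · exact run36C k h' (by omega)

end FordP1
end Literature.NumberTheory.LFunctions
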